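import Summits.BirchSwinnertonDyer.BirchSwinnertonDyer.Theorems.KimAtThreeD7uTamagawaIndexCorollaries
import Summits.BirchSwinnertonDyer.BirchSwinnertonDyer.Theorems.KimAtThreeD7uKolyvaginPairBlochKato
import Summits.BirchSwinnertonDyer.Rank1Residual.GaloisImage.PropagatedConditionTopOfNoTorsionAnyPrime
import Summits.BirchSwinnertonDyer.Rank1Residual.GaloisImage.CanonicalComparisonLevelChange
import HarnessLib

/-!
# The TAMAGAWA-DIVISIBLE bad places, XVI: the SHARPNESS inputs — `incl_*` maps `𝓕_can` on `E[p^{j+1}]`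
# into [MR04]'s `𝓕_u` on `E[p^{k+1}]` as soon as `p^{k-j}` kills every component group, and the
# canonical comparison maps are transported along `incl`
# (cell `bsd-addord`, seat w2-tamdiv gen 6; route W2 `KimAtThreeKolyvagin`, items 19562 / 19679 / 19599 /
# 19560, «TamDiv∞» at Kolyvagin-system level — the answer to «several Tamagawa primes at once»)

HONEST FRAMING: TOOL theorems (no definition, no named fact, no `sorry`); closes nothing by itself;
nothing is booked; BSD is not proved by any of this.  Every prime `p`, every reduction type.

## Why

Parts IX–XV proved the Tamagawa DEFECT for ONE Tamagawa prime: `3^{k+1} ∣ c_ℓ ⇒ KS(E[3^{k+1}], 𝓕_u, 𝒫) = 0`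
for [MR04] Remark A.5's unramified structure `𝓕_u = blochKatoSelmerStructure p (tateTorsionDatum W p k) ⊤`
(Büyükboduk, JNT 129 (2009) Thm. 3.1 / Cor. 3.3 for `T₃E`), and listed «several Tamagawa primes at once
(exponent `v₃(∏ c_ℓ)`)» as not done.  At the level of the MODULE of Kolyvagin systems that stronger form is
FALSE, and the exact threshold is `max_ℓ v_p(c_ℓ)`, not `v_p(∏ c_ℓ)`: the push-forward along the inclusion
`incl : E[p^{j+1}] ↪ E[p^{k+1}]` carries `KS(E[p^{j+1}], 𝓕_can, 𝒫)` INTO `KS(E[p^{k+1}], 𝓕_u, 𝒫)` as soon as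
`p^{k-j}` kills every component group `Φ_w[p^∞]` (`v_p(c_w) ≤ k - j` at every finite `w ∤ p`), injectively
— e.g. two primes with `3 ∥ c_{ℓ₁}`, `3 ∥ c_{ℓ₂}` give `9 ∣ ∏ c_ℓ` and yet `KS(E[9], 𝓕_u) ⊇ incl_* KS(E[3],
𝓕_can) ≠ 0`.  Büyükboduk himself (loc. cit. §1 p. 3, §4.2 Questions 1–2) records that the product form
«escapes our method» and is OPEN in print for `κ^{Kato}` itself.  This file supplies the local and
comparison-map inputs of that push-forward; the sequel (part XVII, `KimAtThreeD7uTamagawaSharp`) assembles it.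

## What

* §1 `nsmul_mem_of_le_of_card_eq_mul` (pure algebra: a subgroup of index `m ∣ n` absorbs `n`-th multiples).
* §2 (local, every `p`, every finite `w ∤ p` of every reduction type)
  `natCard_torsionBy_componentQuotient_dvd_pow_padicValNat` (`#Φ_w[p^{k+1}] ∣ p^{v_p(c_w)}`),
  `pow_smul_mem_blochKatoSelmerStructure_of_mem_propagatedSelmerStructure` (`p^{v_p(c_w)} ∣ p^n ⇒
  p^n · 𝓕_can(w)_k ⊆ 𝓕_u(w)_k`, from part VII's index `#𝓕_can(w)_k = #𝓕_u(w)_k · #Φ_w[p^{k+1}]`), and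
  **`localMap_torsionInclusion_mem_blochKatoSelmerStructure`**: at EVERY place `v`, `incl_*` maps
  `𝓕_can(v)` on `E[p^j·p]` into `𝓕_u(v)` on `E[p^k·p]` (relaxed above `p`) once `p^{v_p(c_w)} ∣ p^{k-j}` at
  every finite `w ∤ p` — on cocycles `incl_* π_{j+1,*}[η] = π_{k+1,*}[p^{k-j} η] = p^{k-j} · π_{k+1,*}[η]`
  (`TransportPrime.localMap_torsionInclusion_tateLocalMap`).
* §4 (levels) `exists_bases_red_of_le` (matched bases under any `red = p^{k-j}`), `red_surjective`,
  `map_torsionInclusion_injective_of_le` (`incl_*` injective on `H¹(ℚ, ·)` when `E[p^k·p]^{Γ_ℚ} = 0`).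
* §3 (generic modules over `ℚ`) **`singularMap_localMap_incl_eq_fs_of_hasCanonicalComparison`**: the
  canonical finite–singular comparison maps at levels `N₁ ∣ N₂` (same `η`) are TRANSPORTED along an
  equivariant `incl : N → M` — the hypothesis `hfs` of n1011-p15's `KSDevissage.isKolyvaginSystem_map` for
  `incl_*` (F-B1b has transport along `red` and reflection along `incl`; this is the third direction).

References: K. Büyükboduk, JNT 129 (2009) §1, §2.1.2 Rem. 2, Thm. 3.1, §4.2 Q. 1–2; B. Mazur, K. Rubin,
Mem. AMS 799 (2004) Prop. 6.2.6, Rem. A.5; K. Rubin, *Euler Systems* Lemma 1.3.5, PCMI 18 Def. 1.9.6;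
C.-H. Kim, AJM 148 §2.1.2, §2.2.2; J. H. Silverman, *AEC* Cor. III.6.4 (b); J. S. Milne, *ADT* I §6.
-/

noncomputable section

-- the cell's Theorems namespace `Summit.BirchSwinnertonDyer.BirchSwinnertonDyer.…` repeats the summit name by design (D-0017)
set_option linter.dupNamespace false

open scoped Classical NumberField ContRepresentation
open Function Field NumberField IsDedekindDomain Module
open WeierstrassCurve Literature.NumberTheory.EllipticCurves Literature.NumberTheory.GaloisRepresentations
  Literature.NumberTheory.GaloisRepresentations.DiscreteGaloisModule Literature.NumberTheory.GaloisCohomology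
open Summit.BirchSwinnertonDyer.Rank1Residual Summit.BirchSwinnertonDyer.Rank1Residual.GaloisImage
open Summit.BirchSwinnertonDyer.BirchSwinnertonDyer.Theorems.KimAtThreeD7uBlochKatoCondition
open Summit.BirchSwinnertonDyer.BirchSwinnertonDyer.Theorems.KimAtThreeD7uKolyvaginPairBlochKato
open Summit.BirchSwinnertonDyer.BirchSwinnertonDyer.Theorems.KimAtThreeD7uTamagawaIndex

namespace Summit.BirchSwinnertonDyer.BirchSwinnertonDyer.Theorems.KimAtThreeD7uTamagawaSharp

/-! ### §1 Pure algebra: a subgroup of index dividing `n` absorbs `n`-th multiples -/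

/-- If `A ≤ B` are subgroups of an abelian group, `B` finite, `#B = #A · m` and `m ∣ n`, then `n • x ∈ A`
for every `x ∈ B` (the quotient `B/A` has order `m`, Lagrange). [folklore] -/
theorem nsmul_mem_of_le_of_card_eq_mul {G : Type*} [AddCommGroup G] {A B : AddSubgroup G}
    (hAB : A ≤ B) (hB : Finite B) {m n : ℕ} (hcard : Nat.card B = Nat.card A * m) (hmn : m ∣ n)
    {x : G} (hx : x ∈ B) : n • x ∈ A := by
  haveI := hB
  haveI : Finite A := Finite.of_injective _ (AddSubgroup.inclusion_injective hAB)
  have hA : Nat.card (A.addSubgroupOf B) = Nat.card A :=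
    Nat.card_congr (AddSubgroup.addSubgroupOfEquivOfLe hAB).toEquiv
  have hq : Nat.card (B ⧸ A.addSubgroupOf B) = m := by
    have h := AddSubgroup.card_eq_card_quotient_mul_card_addSubgroup (A.addSubgroupOf B)
    rw [hA, hcard, mul_comm] at h
    exact (Nat.eq_of_mul_eq_mul_right Nat.card_pos h).symm
  have hord : addOrderOf (QuotientAddGroup.mk (s := A.addSubgroupOf B) (⟨x, hx⟩ : B)) ∣ n :=
    (addOrderOf_dvd_natCard _).trans (hq ▸ hmn)
  have h0 := addOrderOf_dvd_iff_nsmul_eq_zero.mp hord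
  rw [← QuotientAddGroup.mk_nsmul, QuotientAddGroup.eq_zero_iff] at h0
  exact AddSubgroup.mem_addSubgroupOf.mp h0

/-! ### §2 Local: `incl_*` maps `𝓕_can(E[p^{j+1}])` into `𝓕_u(E[p^{k+1}])` once `p^{k-j}` kills the
component groups -/

section Local

variable (W : WeierstrassCurve ℚ) [W.IsElliptic] (p : ℕ) [hp : Fact p.Prime] {j k : ℕ}

/-- `#Φ_w[p^{k+1}]` divides `p^{v_p(c_w)}`: the `p^{k+1}`-torsion of the component quotient
`Φ_w = X(ℚ_w)/X₀(ℚ_w)` (of order `c_w`) lies in its `p`-primary part, of order `p^{v_p(c_w)}`.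
[folklore] -/
theorem natCard_torsionBy_componentQuotient_dvd_pow_padicValNat (k : ℕ) (w : HeightOneSpectrum (𝓞 ℚ)) :
    Nat.card (AddSubgroup.torsionBy
        (((W.localMinimalIntegralModel w).baseChange (w.adicCompletion ℚ)).toAffine.Point ⧸
          (W.localMinimalIntegralModel w).nonsingularReductionSubgroup
            (integers_valuationRing_valuation (w.adicCompletionIntegers ℚ) (w.adicCompletion ℚ)))
        (p ^ (k + 1) : ℕ)) ∣
      p ^ padicValNat p ((W.baseChange (w.adicCompletion ℚ)).localTamagawaNumber
        (w.adicCompletionIntegers ℚ)) := by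
  haveI := finite_componentQuotient W w
  set Q := ((W.localMinimalIntegralModel w).baseChange (w.adicCompletion ℚ)).toAffine.Point ⧸
    (W.localMinimalIntegralModel w).nonsingularReductionSubgroup
      (integers_valuationRing_valuation (w.adicCompletionIntegers ℚ) (w.adicCompletion ℚ)) with hQ
  rw [← natCard_componentQuotient_eq_localTamagawaNumber W w,
    ← Literature.NumberTheory.EllipticCurves.natCard_primaryComponent_eq_pow_padicValNat p]
  refine AddSubgroup.card_dvd_of_le fun x hx => ?_
  exact (AddCommGroup.mem_primaryComponent).mpr ⟨k + 1, (AddSubgroup.torsionBy.nsmul_iff).mp hx⟩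

/-- **At a finite `w ∤ p`, `p^{k-j} · 𝓕_can(w)_k ⊆ 𝓕_u(w)_k` as soon as `p^{v_p(c_w)} ∣ p^{k-j}`**: the
index `[𝓕_can(w)_k : 𝓕_u(w)_k] = #Φ_w[p^{k+1}]` (part VII) divides `p^{v_p(c_w)}`.
[cite: MazurRubin2004, Prop. 6.2.6 (p. 75) and App. A Remark A.5 (p. 81)] [cite: Rubin2000, Lemma 1.3.5] -/
theorem pow_smul_mem_blochKatoSelmerStructure_of_mem_propagatedSelmerStructure (k n : ℕ)
    (L : (tateTorsionDatum W p k).LocalConditionsAbove p) {w : HeightOneSpectrum (𝓞 ℚ)}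
    (hw : ((p : ℕ) : 𝓞 ℚ) ∉ w.asIdeal)
    (htam : p ^ padicValNat p ((W.baseChange (w.adicCompletion ℚ)).localTamagawaNumber
      (w.adicCompletionIntegers ℚ)) ∣ p ^ n)
    {x : galoisCohomology ((W.torsionGaloisModule ((p : ℤ) ^ k * (p : ℤ))).toLocal (Sum.inr w)) 1}
    (hx : x ∈ propagatedSelmerStructure W p k (Sum.inr w)) :
    p ^ n • x ∈ blochKatoSelmerStructure p (tateTorsionDatum W p k) L (Sum.inr w) := by
  exact nsmul_mem_of_le_of_card_eq_mul
    (blochKatoSelmerStructure_inr_le_propagatedSelmerStructure W p k w L hw)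
    (finite_propagatedSelmerStructure_inr W p k w hw)
    (natCard_propagatedSelmerStructure_inr_eq_mul W p k w hw L)
    ((natCard_torsionBy_componentQuotient_dvd_pow_padicValNat W p k w).trans htam) hx

/-- **`incl_*` maps `𝓕_can` on `E[p^{j+1}]` into [MR04]'s `𝓕_u` on `E[p^{k+1}]` at EVERY place, as soon as
`p^{v_p(c_w)} ∣ p^{k-j}` at every finite `w ∤ p`** (`incl : E[p^j·p] ↪ E[p^k·p]`, `j ≤ k`; `𝓕_u` relaxed
above `p`): on a crossed homomorphism `η : Γ_{ℚ_v} → T_pE`, `incl_* π_{j+1,*}[η] = π_{k+1,*}[p^{k-j} η]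
= p^{k-j} · π_{k+1,*}[η]`, and `p^{k-j}` kills `𝓕_can(w)_k/𝓕_u(w)_k ≅ Φ_w[p^{k+1}]`; above `p` and at `∞`
the two structures impose the same (no) condition. [cite: MazurRubin2004, App. A Remark A.5 (p. 81)]
[cite: Buyukboduk2009TamagawaDefect, §2.1.2 Remark 2] -/
theorem localMap_torsionInclusion_mem_blochKatoSelmerStructure (hjk : j ≤ k)
    (htam : ∀ w : HeightOneSpectrum (𝓞 ℚ), ((p : ℕ) : 𝓞 ℚ) ∉ w.asIdeal →
      p ^ padicValNat p ((W.baseChange (w.adicCompletion ℚ)).localTamagawaNumber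
        (w.adicCompletionIntegers ℚ)) ∣ p ^ (k - j))
    (v : Place ℚ)
    {y : galoisCohomology ((W.torsionGaloisModule ((p : ℤ) ^ j * (p : ℤ))).toLocal v) 1}
    (hy : y ∈ propagatedSelmerStructure W p j v) :
    localMap (W.torsionInclusion (mul_dvd_mul_right (pow_dvd_pow (p : ℤ) hjk) (p : ℤ))) v y ∈
      blochKatoSelmerStructure p (tateTorsionDatum W p k) (fun _ _ => ⊤) v := by
  obtain ⟨z, rfl⟩ := (mem_propagatedSelmerStructure_iff W p j v y).mp hy
  obtain ⟨η, rfl⟩ := oneCocycleClass_surjective (tateLocalRep W p v).toTopRep z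
  rw [TransportPrime.localMap_torsionInclusion_tateLocalMap W p hjk v η]
  cases v with
  | inl w => exact AddSubgroup.mem_top _
  | inr w =>
    by_cases hw : ((p : ℕ) : 𝓞 ℚ) ∈ w.asIdeal
    · rw [blochKatoSelmerStructure_relaxed_inr_eq_propagatedSelmerStructure W p k w hw]
      exact (mem_propagatedSelmerStructure_iff W p k _ _).mpr ⟨_, rfl⟩
    · have hx : tateLocalMap W p k (Sum.inr w) (oneCocycleClass (tateLocalRep W p (Sum.inr w)).toTopRep η) ∈
          propagatedSelmerStructure W p k (Sum.inr w) :=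
        (mem_propagatedSelmerStructure_iff W p k _ _).mpr ⟨_, rfl⟩
      have h := pow_smul_mem_blochKatoSelmerStructure_of_mem_propagatedSelmerStructure W p k (k - j)
        (fun _ _ => ⊤) hw (htam w hw) hx
      have h1 : (oneCocycleClass (tateLocalRep W p (Sum.inr w)).toTopRep ((((p ^ (k - j) : ℕ)) : ℤ) • η) :
          (tateLocalRep W p (Sum.inr w)).cohomology 1) =
          p ^ (k - j) • oneCocycleClass (tateLocalRep W p (Sum.inr w)).toTopRep η := by
        have h := oneCocycleClass_smul (tateLocalRep W p (Sum.inr w)).toTopRep (((p ^ (k - j) : ℕ)) : ℤ) η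
        conv at h => rhs; rw [Nat.cast_smul_eq_nsmul]
        exact h
      have heq : tateLocalMap W p k (Sum.inr w)
          (oneCocycleClass (tateLocalRep W p (Sum.inr w)).toTopRep ((((p ^ (k - j) : ℕ)) : ℤ) • η)) =
          p ^ (k - j) • tateLocalMap W p k (Sum.inr w) (oneCocycleClass (tateLocalRep W p (Sum.inr w)).toTopRep η) := by
        rw [h1]
        exact map_nsmul (tateLocalMap W p k (Sum.inr w)) (p ^ (k - j)) _
      exact heq ▸ h

end Local
/-! ### §4 `E`-specific inputs for the push-forward along `incl : E[p^j·p] ↪ E[p^k·p]`: matched bases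
for the reduction `red : E[p^k·p] → E[p^j·p]`, and injectivity of `incl_*` on `H¹(ℚ, ·)` -/

section Levels

variable (W : WeierstrassCurve ℚ) [W.IsElliptic] (p : ℕ) [hp : Fact p.Prime] {j k : ℕ}

omit hp in
/-- `p^j·p ∣ p^k·p` in `ℤ` for `j ≤ k` (the inclusion `E[p^{j+1}] ⊆ E[p^{k+1}]`; the term by which the
generic-prime transport lemma `TransportPrime.localMap_torsionInclusion_tateLocalMap` spells it). [folklore] -/
theorem pow_mul_dvd_pow_mul_of_le (hjk : j ≤ k) : (p : ℤ) ^ j * (p : ℤ) ∣ (p : ℤ) ^ k * (p : ℤ) :=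
  mul_dvd_mul_right (pow_dvd_pow (p : ℤ) hjk) (p : ℤ)

omit hp in
/-- The `ℤ/p^{j+1}`-rank of `E[p^j·p]` is `2`. [cite: SilvermanAEC2009, Cor. III.6.4(b)] -/
theorem finrank_geomTorsion_pow_mul [Fact p.Prime] (j : ℕ) :
    Module.finrank (ZMod (p ^ (j + 1))) (geomTorsion W ((p : ℤ) ^ j * (p : ℤ))) = 2 := by
  haveI : Fact (1 < p ^ (j + 1)) :=
    ⟨Nat.one_lt_pow (Nat.succ_ne_zero _) (Fact.out : p.Prime).one_lt⟩
  obtain ⟨e⟩ := nonempty_linearEquiv_prod_geomTorsion W p j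
  rw [← e.finrank_eq, Module.finrank_prod, Module.finrank_self]

omit [W.IsElliptic] in
/-- A reduction `red : E[p^k·p] → E[p^j·p]` acting as `x ↦ p^{k-j} x` on points is ONTO (divisibility of
`E(ℚ̄)`). [cite: MilneADT2006, Ch. I §6, proof of Prop. 6.9] -/
theorem red_surjective (hjk : j ≤ k)
    (red : (W.torsionGaloisModule ((p : ℤ) ^ k * (p : ℤ))).toContRepresentation →ⁱL
      (W.torsionGaloisModule ((p : ℤ) ^ j * (p : ℤ))).toContRepresentation)
    (hred : ∀ x : geomTorsion W ((p : ℤ) ^ k * (p : ℤ)),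
      ((red x : geomTorsion W ((p : ℤ) ^ j * (p : ℤ))) : geomPoints W) =
        ((p : ℤ) ^ (k - j)) • (x : geomPoints W)) :
    Function.Surjective red := fun Q => by
  have hpk : ((p : ℤ) ^ (k - j)) ≠ 0 := pow_ne_zero _ (Int.natCast_ne_zero.mpr hp.out.ne_zero)
  obtain ⟨P, hP⟩ := W.zsmul_geomPoints_surjective_of_charZero hpk (Q : geomPoints W)
  have hP' : ((p : ℤ) ^ (k - j)) • P = (Q : geomPoints W) := hP
  have hPmem : P ∈ geomTorsion W ((p : ℤ) ^ k * (p : ℤ)) := by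
    rw [mem_geomTorsion_iff, show (p : ℤ) ^ k * (p : ℤ) = ((p : ℤ) ^ j * (p : ℤ)) * (p : ℤ) ^ (k - j) by
      rw [mul_right_comm, ← pow_add, Nat.add_sub_cancel' hjk], mul_zsmul, hP']
    exact (mem_geomTorsion_iff W _ _).mp Q.2
  refine ⟨⟨P, hPmem⟩, Subtype.ext ?_⟩
  rw [hred]
  exact hP'

/-- **A `ℤ/p^{k+1}`-basis of `E[p^k·p]` maps under `red` to a `ℤ/p^{j+1}`-basis of `E[p^j·p]`** (both free
of rank `2`, `red` onto and `ℤ/p^{k+1} → ℤ/p^{j+1}`-semilinear): the matched-basis hypothesis of the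
comparison-map transport lemmas (n1011-p15 F-B1b; n1011-p11 `TorsionLevel.exists_bases_red` is the case
`k = j + 1`, `p = 3`). [cite: SilvermanAEC2009, Cor. III.6.4(b)] -/
theorem exists_bases_red_of_le (hjk : j ≤ k)
    (red : (W.torsionGaloisModule ((p : ℤ) ^ k * (p : ℤ))).toContRepresentation →ⁱL
      (W.torsionGaloisModule ((p : ℤ) ^ j * (p : ℤ))).toContRepresentation)
    (hred : ∀ x : geomTorsion W ((p : ℤ) ^ k * (p : ℤ)),
      ((red x : geomTorsion W ((p : ℤ) ^ j * (p : ℤ))) : geomPoints W) =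
        ((p : ℤ) ^ (k - j)) • (x : geomPoints W)) :
    ∃ (n : ℕ) (b : Basis (Fin n) (ZMod (p ^ (k + 1))) (geomTorsion W ((p : ℤ) ^ k * (p : ℤ))))
      (b' : Basis (Fin n) (ZMod (p ^ (j + 1))) (geomTorsion W ((p : ℤ) ^ j * (p : ℤ)))),
      ∀ i, red (b i) = b' i := by
  classical
  haveI : NeZero (p ^ (k + 1)) := ⟨pow_ne_zero _ hp.out.ne_zero⟩
  haveI : Fact (1 < p ^ (k + 1)) := ⟨Nat.one_lt_pow (Nat.succ_ne_zero _) hp.out.one_lt⟩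
  haveI : Fact (1 < p ^ (j + 1)) := ⟨Nat.one_lt_pow (Nat.succ_ne_zero _) hp.out.one_lt⟩
  let b₀ := Module.Free.chooseBasis (ZMod (p ^ (k + 1))) (geomTorsion W ((p : ℤ) ^ k * (p : ℤ)))
  let b := b₀.reindex (Fintype.equivFin _)
  have hcard : Fintype.card (Fin (Fintype.card (Module.Free.ChooseBasisIndex (ZMod (p ^ (k + 1)))
      (geomTorsion W ((p : ℤ) ^ k * (p : ℤ)))))) =
      Module.finrank (ZMod (p ^ (j + 1))) (geomTorsion W ((p : ℤ) ^ j * (p : ℤ))) := by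
    rw [Fintype.card_fin, ← Module.finrank_eq_card_chooseBasisIndex, finrank_geomTorsion_pow_mul W p k,
      finrank_geomTorsion_pow_mul W p j]
  have hspan : ⊤ ≤ Submodule.span (ZMod (p ^ (j + 1))) (Set.range fun i => red (b i)) := by
    rintro x -
    obtain ⟨y, hy⟩ := red_surjective W p hjk red hred x
    rw [← hy, ← b.sum_repr y, map_sum]
    refine Submodule.sum_mem _ fun i _ => ?_
    rw [KSDevissage.map_zmod_smul_eq_castHom_smul (pow_dvd_pow p (Nat.succ_le_succ hjk)) red]
    exact Submodule.smul_mem _ _ (Submodule.subset_span ⟨i, rfl⟩)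
  exact ⟨_, b, basisOfTopLeSpanOfCardEqFinrank (fun i => red (b i)) hspan hcard, fun i => by
    rw [coe_basisOfTopLeSpanOfCardEqFinrank]⟩

omit [W.IsElliptic] hp in
/-- **`incl_* : H¹(ℚ, E[p^j·p]) → H¹(ℚ, E[p^k·p])` is injective when `E[p^k·p]` has no `Γ_ℚ`-fixed point**
(`j ≤ k`; the kernel is the image of the connecting map from `H⁰(ℚ, E[p^k·p]/E[p^j·p])`, and a class in it
is `δ(b)` with `p^{j+1} b` a fixed point; X11b `Levels.map_one_injective_of_forall_fixed_eq_zero`;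
n1011-p11 `Transport.map_torsionInclusion_injective` is the case `p = 3`).
[cite: GreenbergLNM1716, §2 p. 63] -/
theorem map_torsionInclusion_injective_of_le (hjk : j ≤ k)
    (h0 : ∀ P : geomTorsion W ((p : ℤ) ^ k * (p : ℤ)),
      (∀ σ : absoluteGaloisGroup ℚ, W.torsionGaloisModule ((p : ℤ) ^ k * (p : ℤ)) σ P = P) → P = 0) :
    Function.Injective
      (galoisCohomology.map (W.torsionInclusion (pow_mul_dvd_pow_mul_of_le p hjk)) 1) := by
  have hlev : ((p : ℤ) ^ j * (p : ℤ)) = ((p ^ (j + 1) : ℕ) : ℤ) := by push_cast; ring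
  refine X11b.Levels.map_one_injective_of_forall_fixed_eq_zero (n := p ^ (j + 1)) ?_ ?_ ?_ ?_
  · -- every `p^{j+1}`-torsion point of `E[p^{k+1}]` lies in `E[p^{j+1}]`
    intro b hb
    have hb' : ((p : ℤ) ^ j * (p : ℤ)) • (b : geomPoints W) = 0 := by
      rw [hlev, natCast_zsmul, ← AddSubmonoidClass.coe_nsmul, hb, ZeroMemClass.coe_zero]
    exact ⟨⟨(b : geomPoints W), (mem_geomTorsion_iff _ _ _).2 hb'⟩, Subtype.ext rfl⟩
  · intro a a' h
    exact Subtype.ext (congrArg (fun P : geomTorsion W ((p : ℤ) ^ k * (p : ℤ)) => (P : geomPoints W)) h)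
  · exact pow_succ_nsmul_geomTorsion_eq_zero W p j
  · exact h0

end Levels
/-! ### §3 TRANSPORT of the canonical comparison maps along an inclusion `incl : N → M` -/

section Comparison

open Polynomial
open Summit.BirchSwinnertonDyer.Rank1Residual.GaloisImage.KSDevissage

variable {M : Type} [AddCommGroup M] [TopologicalSpace M] [DiscreteTopology M]
  {N : Type} [AddCommGroup N] [TopologicalSpace N] [DiscreteTopology N]
  {ρM : DiscreteGaloisModule ℚ M} {ρN : DiscreteGaloisModule ℚ N}
  {N₁ N₂ : ℕ} [Fact (1 < N₁)] [NeZero N₂]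
  [Module (ZMod N₂) M] [Module.Free (ZMod N₂) M] [Module.Finite (ZMod N₂) M]
  [Module (ZMod N₁) N] [Module.Free (ZMod N₁) N] [Module.Finite (ZMod N₁) N]

/-- **TRANSPORT of the canonical comparison maps along an INCLUSION `incl : N → M`** (the hypothesis
`hfs` of n1011-p15's `KSDevissage.isKolyvaginSystem_map` for the PUSH-FORWARD `incl_*`; the companion
of `singularMap_localMap_eq_fs_of_hasCanonicalComparison` (transport along a reduction) and of
`singularMap_eq_fs_of_localMap_of_hasCanonicalComparison` (reflection along `incl`)).  Over `ℚ`, let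
`D_M` (level `N₂`) and `D_N` (level `N₁ ∣ N₂`) carry THE canonical comparison maps with the same
primitive roots `η`, let `𝔮` be a prime of both data at which `M` and `N` are unramified, let
`red : M → N` be equivariant carrying a `ℤ/N₂`-basis to a `ℤ/N₁`-basis (so `Q_N = Q_M mod N₁`) and
`incl : N → M` equivariant.  If `w` represents `φ^{fs}_𝔮(y)` modulo `H¹_ur(ℚ_𝔮, N)` for an unramified
`y ∈ H¹(ℚ_𝔮, N)`, then `incl_* w` represents `φ^{fs}_𝔮(incl_* y)` modulo `H¹_ur(ℚ_𝔮, M)`: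
`(incl ∘ w)(τ) = incl (Q_N(φ⁻¹) z(φ)) = Q_M(φ⁻¹) (incl ∘ z)(φ) = w₃(τ)` for any representative `w₃` of
`φ^{fs}(incl_* y)` and every inertia `τ` over `η_𝔮`, so `incl ∘ w − w₃` is unramified. [cite: Rubin2011, Def. 1.9.6 (p. 14)]
[cite: Kim2022StructureSelmer, §2.1.2 and §2.2.2] -/
theorem singularMap_localMap_incl_eq_fs_of_hasCanonicalComparison (hdvd : N₁ ∣ N₂)
    (red : ρM.toContRepresentation →ⁱL ρN.toContRepresentation)
    {ι : Type*} [Fintype ι] [DecidableEq ι] (b : Basis ι (ZMod N₂) M) (b' : Basis ι (ZMod N₁) N)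
    (hb : ∀ i, red (b i) = b' i)
    (incl : ρN.toContRepresentation →ⁱL ρM.toContRepresentation)
    {DM : KolyvaginDatum ρM} {DN : KolyvaginDatum ρN}
    {η : (q : HeightOneSpectrum (𝓞 ℚ)) → (ZMod (Ideal.absNorm q.asIdeal))ˣ}
    (hDM : DM.HasCanonicalComparison N₂ η) (hDN : DN.HasCanonicalComparison N₁ η)
    {q : HeightOneSpectrum (𝓞 ℚ)} (hqM : q ∈ DM.primes) (hqN : q ∈ DN.primes)
    (hurM : GaloisRep.IsUnramifiedAt q ρM) (hurN : GaloisRep.IsUnramifiedAt q ρN)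
    {y : galoisCohomology (GaloisRep.toLocal q ρN) 1}
    (hy : y ∈ unramifiedSubgroup (GaloisRep.toLocal q ρN) 1)
    (w : galoisCohomology (GaloisRep.toLocal q ρN) 1)
    (hw : singularMap (GaloisRep.toLocal q ρN) w = DN.fs q y) :
    singularMap (GaloisRep.toLocal q ρM) (localMap incl (Sum.inr q) w) =
      DM.fs q (localMap incl (Sum.inr q) y) := by
  classical
  set L := q.adicCompletion ℚ
  have hIM : ∀ t ∈ absInertia L, GaloisRep.toLocal q ρM t = 1 := fun t ht =>
    (GaloisRep.isUnramifiedAt_iff_toLocal_holds q ρM).1 hurM t ht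
  have hIN : ∀ t ∈ absInertia L, GaloisRep.toLocal q ρN t = 1 := fun t ht =>
    (GaloisRep.isUnramifiedAt_iff_toLocal_holds q ρN).1 hurN t ht
  have hIM' : ∀ t ∈ absInertia L, ∀ m : M, GaloisRep.toLocal q ρM t m = m := fun t ht m => by
    rw [hIM t ht, Module.End.one_apply]
  have hIN' : ∀ t ∈ absInertia L, ∀ n : N, GaloisRep.toLocal q ρN t n = n := fun t ht n => by
    rw [hIN t ht, Module.End.one_apply]
  have hρred : ∀ (σ : absoluteGaloisGroup L) (m : M),
      red (GaloisRep.toLocal q ρM σ m) = GaloisRep.toLocal q ρN σ (red m) := fun σ m =>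
    red.isIntertwining _ m
  have hρincl : ∀ (σ : absoluteGaloisGroup L) (n : N),
      GaloisRep.toLocal q ρM σ (incl n) = incl (GaloisRep.toLocal q ρN σ n) := fun σ n =>
    (incl.isIntertwining _ n).symm
  obtain ⟨φ, hφ⟩ := exists_isAbsArithFrob_holds (F := L)
  have hgen : Subgroup.zpowers (η q) = ⊤ := hDM.zpowers_eq_top hqM
  have hfib := exists_absInertia_localNormCyclotomicCharacter_eq q (η q)
  have hQ : ∀ φ : absoluteGaloisGroup L,
      DiscreteGaloisModule.comparisonQ (GaloisRep.toLocal q ρN) N₁ φ =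
        (DiscreteGaloisModule.comparisonQ (GaloisRep.toLocal q ρM) N₂ φ).map
          (ZMod.castHom hdvd (ZMod N₁)) := fun φ =>
    (comparisonQ_eq_map (GaloisRep.toLocal q ρM) (GaloisRep.toLocal q ρN) hdvd b b'
      red.toContinuousLinearMap.toLinearMap.toAddMonoidHom
      (map_zmod_smul_eq_castHom_smul hdvd red.toContinuousLinearMap.toLinearMap.toAddMonoidHom) hb φ (hρred φ)).2
  -- representatives
  obtain ⟨z, rfl⟩ := oneCocycleClass_surjective (GaloisRep.toLocal q ρN).toTopRep y
  obtain ⟨wt, rfl⟩ := oneCocycleClass_surjective (GaloisRep.toLocal q ρN).toTopRep w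
  rw [localMap_inr_oneCocycleClass, localMap_inr_oneCocycleClass]
  set z' := contOneCocycles.pullback (ContinuousMonoidHom.id _)
    (X := (GaloisRep.toLocal q ρN).toTopRep) (Y := (GaloisRep.toLocal q ρM).toTopRep)
    (TopRep.ofHom ⟨(incl.restrictField L).toContinuousLinearMap,
      (incl.restrictField L).isIntertwining'⟩) z with hz'_def
  set wt' := contOneCocycles.pullback (ContinuousMonoidHom.id _)
    (X := (GaloisRep.toLocal q ρN).toTopRep) (Y := (GaloisRep.toLocal q ρM).toTopRep)
    (TopRep.ofHom ⟨(incl.restrictField L).toContinuousLinearMap,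
      (incl.restrictField L).isIntertwining'⟩) wt with hwt'_def
  have hz'app : ∀ g, z'.1 g = incl (z.1 g) := fun g => rfl
  have hwt'app : ∀ g, wt'.1 g = incl (wt.1 g) := fun g => rfl
  -- `z` and `incl ∘ z` vanish on inertia
  have hz0 : ∀ t ∈ absInertia L, z.1 t = 0 :=
    (X11b.LocBridge.mem_unramifiedSubgroup_one_iff_forall_eq_zero _ hIN' z).mp hy
  have hz'ur : oneCocycleClass (GaloisRep.toLocal q ρM).toTopRep z' ∈
      unramifiedSubgroup (GaloisRep.toLocal q ρM) 1 :=
    (X11b.LocBridge.mem_unramifiedSubgroup_one_iff_forall_eq_zero _ hIM' z').mpr fun t ht => by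
      rw [hz'app, hz0 t ht, map_zero]
  -- a representative `w₃` of `φ^{fs}(incl_* y)`
  obtain ⟨c₃, hc₃⟩ := QuotientAddGroup.mk_surjective
    (DM.fs q (oneCocycleClass (GaloisRep.toLocal q ρM).toTopRep z'))
  obtain ⟨w₃, rfl⟩ := oneCocycleClass_surjective (GaloisRep.toLocal q ρM).toTopRep c₃
  have hw₃ : singularMap (GaloisRep.toLocal q ρM) (oneCocycleClass _ w₃) = DM.fs q (oneCocycleClass _ z') :=
    hc₃
  -- `incl ∘ w − w₃` vanishes on the `η`-fibre of inertia, hence on inertia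
  have hvan : ∀ t ∈ absInertia L, (wt' - w₃).1 t = 0 := by
    refine forall_absInertia_apply_eq_zero_of_fibre (GaloisRep.toLocal q ρM) hIM
      (localNormCyclotomicCharacter q) hgen hfib (wt' - w₃) fun t ht hχt => ?_
    have hN := (hDN.at hqN hφ ht hχt).apply_eq z wt hy hw
    have hM := (hDM.at hqM hφ ht hχt).apply_eq z' w₃ hz'ur hw₃
    have hop : DiscreteGaloisModule.comparisonOp (GaloisRep.toLocal q ρM) N₂ φ (incl (z.1 φ)) =
        incl (DiscreteGaloisModule.comparisonOp (GaloisRep.toLocal q ρN) N₁ φ (z.1 φ)) :=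
      comparisonOp_apply_eq_of_incl (GaloisRep.toLocal q ρM) (GaloisRep.toLocal q ρN) hdvd hQ
        incl.toContinuousLinearMap.toLinearMap.toAddMonoidHom
        (zmod_smul_map_eq_map_castHom_smul hdvd incl.toContinuousLinearMap.toLinearMap.toAddMonoidHom)
        hρincl φ (z.1 φ)
    rw [Submodule.coe_sub, ContinuousMap.sub_apply, sub_eq_zero, hwt'app, hM, hz'app, hN]
    exact hop.symm
  have hur : oneCocycleClass (GaloisRep.toLocal q ρM).toTopRep (wt' - w₃) ∈
      unramifiedSubgroup (GaloisRep.toLocal q ρM) 1 :=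
    (X11b.LocBridge.mem_unramifiedSubgroup_one_iff_forall_eq_zero _ hIM' _).mpr hvan
  rw [← hw₃]
  exact (FSComp.singularMap_oneCocycleClass_eq_iff (GaloisRep.toLocal q ρM) wt' w₃).mpr hur

end Comparison

end Summit.BirchSwinnertonDyer.BirchSwinnertonDyer.Theorems.KimAtThreeD7uTamagawaSharp

end
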